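import Summits.CriticalPhenomena.PercolationContinuityZ3.Theorems.PercNearOneGluingNoHeavyLowerTailSahiCombTriWDiamondHall
import Summits.CriticalPhenomena.PercolationContinuityZ3.Theorems.PercNearOneGluingNoHeavyLowerTailSahiCombTriWDiamondStratum

/-!
# `DiamondHall` HOLDS (typed link)

Support file of the one-cut programme (crux `NoHeavyLowerTail`, stmt-CriticalPhenomena-4575; cell `prim-masterthm`, seat P5 gen 30).
`…TriWDiamondHall` (P5 gen 29) states the diamond Hall target `FiveUpSet.DiamondHall` (`diamondDemand ≤ halfChainSupply` for two arbitrary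
diamonds `F₀ ⊆ Fp, Fq ⊆ F₁`, `G₀ ⊆ Gp, Gq ⊆ G₁`, i.e. the token form of `TriWIneq` at `a = 2`) as a `@[conjecture] def`; `…TriWDiamondStratum`
(P5 gen 29) proves the equivalent pair inequality `diamond_pair_nonneg` from the kernel lemma of design P2.  This file records the typed discharge.

* **`FiveUpSet.diamondHall_holds : DiamondHall`** — `diamond_pair_nonneg` + the exact identity `inner_pair_eq_diamond`.
HONEST LABEL: elementary (std axioms). [this work]
-/

namespace Summit.CriticalPhenomena.PercolationContinuityZ3.Theorems

namespace FiveUpSet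

open Finset

/-- **`DiamondHall` holds**: for up-sets `P`, `F₀ ⊆ Fp, Fq ⊆ F₁`, `G₀ ⊆ Gp, Gq ⊆ G₁` of a finite cube, `diamondDemand ≤ halfChainSupply`
(the demand tokens of the eleven diamond classes fit into two copies of the four levels). [this work] -/
theorem diamondHall_holds : DiamondHall := by
  intro γ _ _ P F₀ Fp Fq F₁ G₀ Gp Gq G₁ hP hF₀ hFp hFq hF₁ hG₀ hGp hGq hG₁ hF0p hF0q hFp1 hFq1 hG0p hG0q hGp1 hGq1
  have h := diamond_pair_nonneg P F₀ Fp Fq F₁ G₀ Gp Gq G₁ hP hF₀ hFp hFq hF₁ hG₀ hGp hGq hG₁ hF0p hF0q hFp1 hFq1 hG0p hG0q hGp1 hGq1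
  rw [inner_pair_eq_diamond P F₀ Fp Fq F₁ G₀ Gp Gq G₁ hF0p hF0q hFp1 hFq1 hG0p hG0q hGp1 hGq1] at h
  omega

end FiveUpSet

end Summit.CriticalPhenomena.PercolationContinuityZ3.Theorems
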